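import Summits.CriticalPhenomena.SAWScalingLimit.Theorems.SAWTotalPositivityCriticalBubbleBoundKestenDefs
import Summits.CriticalPhenomena.SAWScalingLimit.Theorems.SAWRenewalTightnessStripMassConservation

/-!
# Line `kesten-product-renewal-dictionary` (crux stmt-CriticalPhenomena-7117): stub B2 — KESTEN'S BOUND
`u_h ≤ 1` on the renewal density

Proof file (lead seat c1). The registered stub B2 of the line (`stub_renewalBound : ∀ h, columnMass h ≤ 1`,
seat …-7117-1's skeleton) is the statement that the critical mass `u_h = Σ_{span W = h} x_c^{|W|}` of the
bridges of `ℤ²` of span exactly `h` is at most one (under Kesten's renewal measure it is the probability of a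
renewal at level `h`). For `h ≥ 1` this is, after unfolding the `tsum` over `Bridge = Σ n, Zd.bridges 2 n` into
its partial sums, EXACTLY the tree theorem `stripMassConservation_proof` (route `SAWRenewalTightness`, item
stmt-CriticalPhenomena-4734: `∑_{n ≤ N} ∑_{ω ∈ bridges 2 n, ω₁(n) = L} x_c^n ≤ 1` for all `L ≥ 1`, `N`;
Kesten 1963 §4 / Madras–Slade 1993 (4.2.9)–(4.2.12)); for `h = 0` the only bridge of span `0` is the empty
one, of mass `x_c^0 = 1`.
-/

noncomputable section

open Literature.Probability.LatticeModels
open Literature.Probability.RandomPlanarGeometry Literature.Probability.RandomPlanarGeometry.SAW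
open scoped ENNReal BigOperators

namespace Summit.CriticalPhenomena.SAWScalingLimit.Theorems.CriticalBubbleBound.Kesten.Cut

/-! ## Unfolding the renewal density into partial sums -/

open Classical in
/-- `u_h` as a series over the length: `u_h = Σ_n Σ_{ω ∈ bridges 2 n, ω₁(n) = h} x_c^n`. [folklore] -/
theorem columnMass_eq_tsum_sum (h : ℕ) :
    columnMass h = ∑' n : ℕ, ∑ _ω ∈ (Zd.bridges 2 n).filter (fun ω => ω n 0 = (h : ℤ)),
      ENNReal.ofReal (criticalFugacity ^ n) := by
  rw [columnMass, ENNReal.tsum_sigma']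
  refine tsum_congr fun n => ?_
  rw [Finset.sum_filter]
  exact Finset.tsum_subtype (Zd.bridges 2 n)
    (fun ω => if ω n 0 = (h : ℤ) then ENNReal.ofReal (criticalFugacity ^ n) else 0)

open Classical in
/-- The partial sums of that series are the sums bounded by `StripMassConservation`. [folklore] -/
theorem sum_range_eq_ofReal (h N : ℕ) :
    ∑ n ∈ Finset.range (N + 1), ∑ _ω ∈ (Zd.bridges 2 n).filter (fun ω => ω n 0 = (h : ℤ)),
        ENNReal.ofReal (criticalFugacity ^ n) =
      ENNReal.ofReal (∑ n ∈ Finset.range (N + 1),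
        ∑ _ω ∈ (Zd.bridges 2 n).filter (fun ω => ω n 0 = (h : ℤ)), criticalFugacity ^ n) := by
  have hx : 0 ≤ criticalFugacity := criticalFugacity_pos_lt_one'.1.le
  rw [ENNReal.ofReal_sum_of_nonneg fun n _ => Finset.sum_nonneg fun _ _ => pow_nonneg hx _]
  refine Finset.sum_congr rfl fun n _ => ?_
  rw [ENNReal.ofReal_sum_of_nonneg fun _ _ => pow_nonneg hx _]

/-! ## Span `0`: only the empty bridge -/

/-- A bridge of positive length has positive span; so span `0` forces the empty bridge. [cite: MadrasSlade1993, Definition 1.2.4] -/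
theorem len_eq_zero_of_span_eq_zero (W : Bridge) (h : W.span = 0) : W.len = 0 := by
  by_contra hne
  have hpos : 1 ≤ W.len := Nat.one_le_iff_ne_zero.2 hne
  have hb := (W.mem_saws_isBridge).2 W.len hpos le_rfl
  have h00 : W.fn 0 0 = 0 := by rw [W.fn_zero]; rfl
  have : (0 : ℤ) < W.span := by
    have := hb.1.trans_le hb.2
    rwa [h00] at this
  omega

/-- The empty bridge. [cite: MadrasSlade1993, Definition 1.2.4] -/
theorem zero_mem_bridges_zero : (fun _ : ℕ => (0 : Site 2)) ∈ Zd.bridges 2 0 := by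
  refine Zd.mem_bridges.2 ⟨Zd.mem_saws.2 ⟨rfl, fun _ _ => rfl, fun i hi => absurd hi (Nat.not_lt_zero i),
    fun i hi j hj _ => ?_⟩, fun i h1 h2 => absurd (h1.trans h2) (by norm_num)⟩
  simp only [Set.mem_setOf_eq, Nat.le_zero] at hi hj
  rw [hi, hj]

/-- A bridge of length `0` is the empty bridge. [cite: MadrasSlade1993, Definition 1.2.4] -/
theorem eq_empty_of_len_eq_zero (W : Bridge) (h : W.len = 0) :
    W = ⟨0, ⟨fun _ => 0, zero_mem_bridges_zero⟩⟩ := by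
  obtain ⟨n, ω, hω⟩ := W
  change n = 0 at h
  subst h
  have hω' : ω = fun _ => 0 := by
    obtain ⟨h0, hfro, -, -⟩ := Zd.mem_saws.1 (Zd.mem_bridges.1 hω).1
    funext i
    rw [hfro i (Nat.zero_le i), h0]
  subst hω'
  rfl

/-- `u_0 ≤ 1` (in fact `= 1`: the empty bridge alone). [cite: MadrasSlade1993, §4.2] -/
theorem columnMass_zero_le : columnMass 0 ≤ 1 := by
  classical
  set W₀ : Bridge := ⟨0, ⟨fun _ => 0, zero_mem_bridges_zero⟩⟩ with hW₀
  calc columnMass 0 ≤ ∑' W : Bridge, (if W = W₀ then (1 : ℝ≥0∞) else 0) := by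
        rw [columnMass]
        refine ENNReal.tsum_le_tsum fun W => ?_
        by_cases hs : W.span = ((0 : ℕ) : ℤ)
        · have hW : W = W₀ :=
            eq_empty_of_len_eq_zero W (len_eq_zero_of_span_eq_zero W (by simpa using hs))
          rw [if_pos hs, if_pos hW, hW]
          show ENNReal.ofReal (criticalFugacity ^ 0) ≤ 1
          simp
        · rw [if_neg hs]; exact zero_le
    _ = 1 := tsum_ite_eq W₀ 1

/-! ## Kesten's bound -/

/-- **Kesten's renewal bound `u_h ≤ 1`** for every span `h` (registered stub B2 `stub_renewalBound` of the
line; for `h ≥ 1` the partial sums are bounded by the tree theorem `stripMassConservation_proof`).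
[cite: MadrasSlade1993, §4.2, eq. (4.2.9)–(4.2.12)] -/
theorem columnMass_le_one : ∀ h : ℕ, columnMass h ≤ 1 := by
  classical
  intro h
  rcases Nat.eq_zero_or_pos h with rfl | hpos
  · exact columnMass_zero_le
  rw [columnMass_eq_tsum_sum, ENNReal.tsum_eq_iSup_nat]
  refine iSup_le fun N => ?_
  -- `range N ⊆ range (N + 1)`, then the route theorem at `L = h ≥ 1`
  calc ∑ n ∈ Finset.range N, ∑ _ω ∈ (Zd.bridges 2 n).filter (fun ω => ω n 0 = (h : ℤ)),
          ENNReal.ofReal (criticalFugacity ^ n)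
      ≤ ∑ n ∈ Finset.range (N + 1), ∑ _ω ∈ (Zd.bridges 2 n).filter (fun ω => ω n 0 = (h : ℤ)),
          ENNReal.ofReal (criticalFugacity ^ n) :=
        Finset.sum_le_sum_of_subset (Finset.range_subset_range.2 (Nat.le_succ N))
    _ = ENNReal.ofReal (∑ n ∈ Finset.range (N + 1),
          ∑ _ω ∈ (Zd.bridges 2 n).filter (fun ω => ω n 0 = (h : ℤ)), criticalFugacity ^ n) :=
        sum_range_eq_ofReal h N
    _ ≤ ENNReal.ofReal 1 := ENNReal.ofReal_le_ofReal
        (stripMassConservation_proof h (by exact_mod_cast hpos) N)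
    _ = 1 := ENNReal.ofReal_one

/-- Registered-stub form (seat …-7117-1's `stub_renewalBound`, verbatim). [cite: MadrasSlade1993, §4.2] -/
theorem stub_renewalBound : ∀ h : ℕ, columnMass h ≤ 1 := columnMass_le_one

end Summit.CriticalPhenomena.SAWScalingLimit.Theorems.CriticalBubbleBound.Kesten.Cut

end
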